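import Literature.Topology.FourManifolds.SurfaceGroupCharacterPullback
import Literature.Topology.FourManifolds.SurfaceGroupAbelianisationKernels
import Mathlib.LinearAlgebra.Basis.Bilinear
import Mathlib.LinearAlgebra.StdBasis
import Mathlib.LinearAlgebra.Matrix.ToLin
import HarnessLib

/-!
# Every automorphism of the surface group acts on `H₁(Σ_g; ℤ)` by a `±`-symplectic automorphism
# (`im(Aut S_g → GL_{2g}(ℤ)) ⊆ Sp^{±}(2g, ℤ)`; Zieschang–Vogt–Coldewey 3.6.7 (a) + Nielsen 3.3.11)

Topic `Literature/Topology/FourManifolds`; theorems only, over `SurfaceGroupHomology.lean`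
(`symplForm = ν`, `SurfaceGroup.abelianize = ab`), `SurfaceGroupAbelianisationKernels.lean`
(`abelianize_surjective`) and `SurfaceGroupCharacterPullback.lean` (the Heisenberg divisibility
`ν(u, v) ∣ ν(ψ^*u, ψ^*v)` for every homomorphism `ψ` of surface groups).

* `SurfaceGroup.abelianize_hom_eq_of_apply_of`, `SurfaceGroup.exists_linearEquiv_abelianize` —
  an automorphism `φ` of `S_g` induces a `ℤ`-linear automorphism `F = φ_*` of
  `H₁ = ℤ^{2g}` with `ab ∘ φ = F ∘ ab` (the commutator subgroup is characteristic).
* `dotProduct_transpose_apply` — `⟨Fᵀu, w⟩ = ⟨F w, u⟩` for the transpose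
  `(Fᵀu)_x = ⟨F e_x, u⟩` in the letter basis; `symplForm_map_map_of_transpose` — if `Fᵀ` is
  `ε`-symplectic and `F` has a left inverse then `F` is `ε`-symplectic (`MJMᵀ = εJ ⇒ MᵀJM = εJ`,
  via `J² = -1`); `exists_sign_of_natAbs_eq_symplForm` — a bilinear form `B` on `ℤ^{2g}` with
  `|B(u,v)| = |ν(u,v)|` for all `u, v` is `± ν` (uniform sign: test `aᵢ + aⱼ` against `bᵢ + bⱼ`).
* `SurfaceGroup.exists_linearEquiv_symplectic` — **the theorem**: for every automorphism `φ`
  of `S_g` there are `F : H₁ ≃ H₁` and `ε = ±1` with `ab ∘ φ = F ∘ ab` and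
  `ν(F u, F v) = ε ν(u, v)`.  ZVC 3.6.7 (a) states this for the automorphism induced by a
  homeomorphism (`ε = -1` iff orientation-reversing), and every automorphism is induced by a
  homeomorphism (Nielsen 1927 = ZVC 3.3.11 / 5.6.2).  The proof here is algebraic and
  self-contained: by the Heisenberg divisibility applied to `φ` and to `φ⁻¹`,
  `|ν(Fᵀu, Fᵀv)| = |ν(u, v)|` for all `u, v`; the sign is uniform; transpose back.

Not here: `ε = +1` for inner automorphisms / the Torelli and Johnson refinements; the converse
realisation of `Sp^{±}` (`SurfaceGroupSymplecticRealisation.lean` + the (D) move).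

## References

* H. Zieschang, E. Vogt, H.-D. Coldewey, *Surfaces and Planar Discontinuous Groups*, LNM 835,
  Springer (1980), Thm. 3.3.11 (Nielsen), Thm. 3.6.7 (a), eq. 3.6.9 (`AᵗKA = εK`).
  [ZieschangVogtColdewey1980]
* J. Nielsen, Untersuchungen zur Topologie der geschlossenen zweiseitigen Flächen, Acta Math. 50
  (1927). [Nielsen1927]
-/

noncomputable section

namespace Literature.Topology.FourManifolds

open Multiplicative

/-! ### The induced map on `H₁` -/

/-- A homomorphism `ψ : S_g → S_{g'}` and a linear map `f : ℤ^{2g} → ℤ^{2g'}` that agree on the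
generators through `ab` agree everywhere: `ab ∘ ψ = f ∘ ab`. [folklore] -/
theorem SurfaceGroup.abelianize_hom_eq_of_apply_of {g g' : ℕ}
    (ψ : SurfaceGroup g →* SurfaceGroup g') (f : (surfaceGen g → ℤ) →ₗ[ℤ] (surfaceGen g' → ℤ))
    (h : ∀ x : surfaceGen g,
      toAdd (SurfaceGroup.abelianize g' (ψ (PresentedGroup.of x))) = f (Pi.single x 1))
    (s : SurfaceGroup g) :
    toAdd (SurfaceGroup.abelianize g' (ψ s)) = f (toAdd (SurfaceGroup.abelianize g s)) := by
  have key : (SurfaceGroup.abelianize g').comp ψ =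
      (AddMonoidHom.toMultiplicative f.toAddMonoidHom).comp (SurfaceGroup.abelianize g) := by
    refine PresentedGroup.ext fun x => ?_
    rw [MonoidHom.comp_apply, MonoidHom.comp_apply, SurfaceGroup.abelianize_of,
      AddMonoidHom.toMultiplicative_apply_apply, toAdd_ofAdd, LinearMap.toAddMonoidHom_coe, ← h,
      ofAdd_toAdd]
  have := DFunLike.congr_fun key s
  rw [MonoidHom.comp_apply, MonoidHom.comp_apply, AddMonoidHom.toMultiplicative_apply_apply,
    LinearMap.toAddMonoidHom_coe] at this
  rw [this, toAdd_ofAdd]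

/-- **The action of `Aut S_g` on `H₁(Σ_g; ℤ) = ℤ^{2g}`**: every automorphism `φ` of the surface
group induces a `ℤ`-linear automorphism `F` of `ℤ^{2g}` with `ab ∘ φ = F ∘ ab` (`ab` is onto and
its kernel, the commutator subgroup, is characteristic). [folklore] -/
theorem SurfaceGroup.exists_linearEquiv_abelianize {g : ℕ} (φ : SurfaceGroup g ≃* SurfaceGroup g) :
    ∃ F : (surfaceGen g → ℤ) ≃ₗ[ℤ] (surfaceGen g → ℤ),
      ∀ s, toAdd (SurfaceGroup.abelianize g (φ s)) = F (toAdd (SurfaceGroup.abelianize g s)) := by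
  classical
  -- the linear maps induced by `φ` and `φ⁻¹` on the free module `ℤ^{2g}`
  let F₀ : (SurfaceGroup g ≃* SurfaceGroup g) → (surfaceGen g → ℤ) →ₗ[ℤ] (surfaceGen g → ℤ) :=
    fun χ => (Pi.basisFun ℤ (surfaceGen g)).constr ℤ
      fun x => toAdd (SurfaceGroup.abelianize g (χ (PresentedGroup.of x)))
  have hF₀ : ∀ (χ : SurfaceGroup g ≃* SurfaceGroup g) s,
      toAdd (SurfaceGroup.abelianize g (χ s)) = F₀ χ (toAdd (SurfaceGroup.abelianize g s)) :=
    fun χ => SurfaceGroup.abelianize_hom_eq_of_apply_of χ.toMonoidHom (F₀ χ) fun x => by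
      rw [MulEquiv.coe_toMonoidHom, ← Pi.basisFun_apply, Module.Basis.constr_basis]
  have hinv : ∀ (χ : SurfaceGroup g ≃* SurfaceGroup g), (F₀ χ).comp (F₀ χ.symm) = LinearMap.id := by
    intro χ
    refine LinearMap.ext fun v => ?_
    obtain ⟨s, hs⟩ := SurfaceGroup.abelianize_surjective g (ofAdd v)
    rw [LinearMap.comp_apply, LinearMap.id_apply, ← toAdd_ofAdd v, ← hs, ← hF₀, ← hF₀,
      MulEquiv.apply_symm_apply]
  refine ⟨LinearEquiv.ofLinear (F₀ φ) (F₀ φ.symm) (hinv φ) ?_, fun s => ?_⟩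
  · have := hinv φ.symm
    rwa [MulEquiv.symm_symm] at this
  · rw [LinearEquiv.ofLinear_apply]
    exact hF₀ φ s

/-! ### Linear algebra of the intersection form: transpose and sign -/

section LinearAlgebra

variable {ι κ : Type*} [Fintype ι] [DecidableEq ι] [Fintype κ]

/-- The transpose in the letter basis: for a linear `F : ℤ^ι → ℤ^κ` and `u ∈ ℤ^κ` put
`(Fᵀu)_x = ⟨F e_x, u⟩`; then `⟨Fᵀu, w⟩ = ⟨F w, u⟩`. [folklore] -/
theorem dotProduct_transpose_apply (F : (ι → ℤ) →ₗ[ℤ] (κ → ℤ)) (u : κ → ℤ) (w : ι → ℤ) :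
    (fun x => F (Pi.single x 1) ⬝ᵥ u) ⬝ᵥ w = F w ⬝ᵥ u := by
  have hw : w = ∑ x, w x • (Pi.single x 1 : ι → ℤ) := by
    ext y
    simp [Finset.sum_apply, Pi.single_apply]
  conv_rhs => rw [hw, map_sum, sum_dotProduct]
  rw [dotProduct]
  refine Finset.sum_congr rfl fun x _ => ?_
  rw [map_smul, smul_dotProduct, smul_eq_mul, mul_comm]

/-- Nondegeneracy of the dot product on `ℤ^ι` (test against the letters). [folklore] -/
theorem eq_of_dotProduct_eq_right {w w' : ι → ℤ} (h : ∀ u, w ⬝ᵥ u = w' ⬝ᵥ u) : w = w' := by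
  funext x
  have := h (Pi.single x 1)
  rwa [dotProduct_single, dotProduct_single, mul_one, mul_one] at this

/-- **Transposing an `ε`-symplectic matrix.**  Let `F` be a linear endomorphism of `ℤ^{ι × Bool}`
with a left inverse `G`, and let `Ft` be its transpose in the letter basis
(`⟨Ft u, w⟩ = ⟨F w, u⟩`).  If `ν(Ft u, Ft v) = ε ν(u, v)` for all `u, v`, then
`ν(F u, F v) = ε ν(u, v)` for all `u, v`.  (Matrix form: `M J Mᵀ = εJ ⇒ Mᵀ J M = εJ`, using
`J² = -1`: from `F J Ft = εJ` get `Ft = -ε J G J`, then `Ft J F = ε J G F = ε J`.) [folklore] -/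
theorem symplForm_map_map_of_transpose (F G : (ι × Bool → ℤ) →ₗ[ℤ] (ι × Bool → ℤ))
    (hGF : ∀ v, G (F v) = v) (Ft : (ι × Bool → ℤ) → (ι × Bool → ℤ))
    (hFt : ∀ u w, Ft u ⬝ᵥ w = F w ⬝ᵥ u) (ε : ℤ)
    (h : ∀ u v, symplForm (Ft u) (Ft v) = ε * symplForm u v) (u v : ι × Bool → ℤ) :
    symplForm (F u) (F v) = ε * symplForm u v := by
  -- `J`: `(j v)_x = ν(e_x, v)`, so that `ν(u, v) = ⟨u, j v⟩` and `j² = -1`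
  set j : (ι × Bool → ℤ) →ₗ[ℤ] (ι × Bool → ℤ) :=
    LinearMap.pi fun x => symplForm (Pi.single x (1 : ℤ)) with hj
  have hjf : ∀ w i, j w (i, false) = w (i, true) := fun w i => by
    rw [hj, LinearMap.pi_apply, symplForm_single_false_left, one_mul]
  have hjt : ∀ w i, j w (i, true) = -w (i, false) := fun w i => by
    rw [hj, LinearMap.pi_apply, symplForm_single_true_left, one_mul]
  have hνj : ∀ u w, symplForm u w = u ⬝ᵥ j w := fun u w => by
    rw [symplForm_apply, dotProduct, Fintype.sum_prod_type]
    refine Finset.sum_congr rfl fun i _ => ?_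
    rw [Fintype.sum_bool, hjf, hjt]
    ring
  have hjj : ∀ w, j (j w) = -w := fun w => by
    funext ⟨i, b⟩
    cases b
    · rw [hjf, hjt, Pi.neg_apply]
    · rw [hjt, hjf, Pi.neg_apply]
  -- step 1: `F J Ft = ε J`
  have h1 : ∀ w, F (j (Ft w)) = ε • j w := fun w =>
    eq_of_dotProduct_eq_right fun u' => by
      rw [← hFt, ← hνj, h, smul_dotProduct, smul_eq_mul, dotProduct_comm, ← hνj]
  -- step 2: `Ft = -ε J G J`
  have h2 : ∀ w, Ft w = -(ε • j (G (j w))) := fun w => by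
    have this : j (G (F (j (Ft w)))) = j (G (ε • j w)) := by rw [h1]
    rw [hGF, hjj, map_smul, map_smul] at this
    rw [← this, neg_neg]
  -- step 3: `Ft J F = ε J`
  calc symplForm (F u) (F v) = F u ⬝ᵥ j (F v) := hνj _ _
    _ = Ft (j (F v)) ⬝ᵥ u := (hFt _ _).symm
    _ = (ε • j v) ⬝ᵥ u := by rw [h2, hjj, map_neg G, map_neg j, smul_neg, neg_neg, hGF]
    _ = ε * symplForm u v := by rw [smul_dotProduct, smul_eq_mul, dotProduct_comm, ← hνj]

/-- **Uniform sign.**  A bilinear form `B` on `ℤ^{ι × Bool}` with `|B(u, v)| = |ν(u, v)|` for all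
`u, v` is `ε ν` for a single sign `ε = ±1`.  (On letters `B(aᵢ, bᵢ) = εᵢ = ±1` and all other
letter pairs vanish; testing `aᵢ + aⱼ` against `bᵢ + bⱼ` gives `|εᵢ + εⱼ| = 2`, so `εᵢ = εⱼ`.)
[folklore] -/
theorem exists_sign_of_natAbs_eq_symplForm (B : LinearMap.BilinForm ℤ (ι × Bool → ℤ))
    (hB : ∀ u v, (B u v).natAbs = (symplForm u v).natAbs) :
    ∃ ε : ℤ, (ε = 1 ∨ ε = -1) ∧ ∀ u v, B u v = ε * symplForm u v := by
  -- `B` vanishes with `ν`; in particular it is alternating, hence skew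
  have h0 : ∀ u v, symplForm u v = 0 → B u v = 0 := fun u v h =>
    Int.natAbs_eq_zero.1 (by rw [hB, h, Int.natAbs_zero])
  have hskew : ∀ u v, B u v = -B v u := fun u v => by
    have h1 := h0 (u + v) (u + v) (symplForm_self _)
    simp only [map_add, LinearMap.add_apply, h0 u u (symplForm_self _),
      h0 v v (symplForm_self _)] at h1
    linarith
  -- the letters
  obtain ⟨a, ha⟩ : ∃ a : ι → ι × Bool → ℤ, ∀ i, a i = Pi.single (i, false) 1 := ⟨_, fun _ => rfl⟩
  obtain ⟨b, hb⟩ : ∃ b : ι → ι × Bool → ℤ, ∀ i, b i = Pi.single (i, true) 1 := ⟨_, fun _ => rfl⟩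
  have hνab : ∀ i j, symplForm (a i) (b j) = if i = j then 1 else 0 := fun i j => by
    rw [ha, hb, symplForm_single_false_left, one_mul, Pi.single_apply]
    simp only [Prod.mk.injEq, and_true]
  have hνaa : ∀ i j, symplForm (a i) (a j) = 0 := fun i j => by
    rw [ha, ha, symplForm_single_false_left, one_mul, Pi.single_apply, if_neg (by simp)]
  have hνbb : ∀ i j, symplForm (b i) (b j) = 0 := fun i j => by
    rw [hb, hb, symplForm_single_true_left, one_mul, Pi.single_apply, if_neg (by simp), neg_zero]
  have hab : ∀ i, B (a i) (b i) = 1 ∨ B (a i) (b i) = -1 := fun i => by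
    have := hB (a i) (b i)
    rw [hνab, if_pos rfl] at this
    exact Int.natAbs_eq_iff.1 this
  have hab' : ∀ i j, i ≠ j → B (a i) (b j) = 0 := fun i j hij => h0 _ _ (by rw [hνab, if_neg hij])
  -- uniform sign
  have heq : ∀ i j, B (a i) (b i) = B (a j) (b j) := fun i j => by
    by_cases hij : i = j
    · rw [hij]
    have hBsum : B (a i + a j) (b i + b j) = B (a i) (b i) + B (a j) (b j) := by
      simp only [map_add, LinearMap.add_apply, hab' i j hij, hab' j i (Ne.symm hij)]
      abel
    have hνsum : symplForm (a i + a j) (b i + b j) = 2 := by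
      simp only [map_add, LinearMap.add_apply, hνab, if_neg hij, if_neg (Ne.symm hij)]
      norm_num
    have h2 := hB (a i + a j) (b i + b j)
    rw [hBsum, hνsum] at h2
    rcases hab i with hi | hi <;> rcases hab j with hj | hj
    · rw [hi, hj]
    · rw [hi, hj] at h2
      simp at h2
    · rw [hi, hj] at h2
      simp at h2
    · rw [hi, hj]
  -- the sign
  obtain hι | ⟨⟨i₀⟩⟩ := isEmpty_or_nonempty ι
  · refine ⟨1, Or.inl rfl, fun u v => ?_⟩
    have hu : u = 0 := funext fun x => isEmptyElim x.1
    rw [hu, map_zero, LinearMap.zero_apply, map_zero, LinearMap.zero_apply, mul_zero]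
  refine ⟨B (a i₀) (b i₀), hab i₀, ?_⟩
  suffices hBB : B = B (a i₀) (b i₀) • symplForm by
    intro u v
    rw [hBB, LinearMap.smul_apply, LinearMap.smul_apply, smul_eq_mul, ← hBB]
  refine LinearMap.ext_basis (Pi.basisFun ℤ (ι × Bool)) (Pi.basisFun ℤ (ι × Bool)) fun x y => ?_
  rw [Pi.basisFun_apply, Pi.basisFun_apply, LinearMap.smul_apply, LinearMap.smul_apply, smul_eq_mul]
  obtain ⟨i, s⟩ := x
  obtain ⟨j, t⟩ := y
  cases s <;> cases t
  · rw [← ha i, ← ha j, hνaa, mul_zero, h0 _ _ (hνaa i j)]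
  · rw [← ha i, ← hb j]
    by_cases hij : i = j
    · subst hij
      rw [hνab, if_pos rfl, mul_one, heq i i₀]
    · rw [hab' i j hij, hνab, if_neg hij, mul_zero]
  · rw [← hb i, ← ha j, hskew, symplForm_comm (b i)]
    by_cases hji : j = i
    · subst hji
      rw [hνab, if_pos rfl, heq j i₀, mul_neg, mul_one]
    · rw [hab' j i hji, hνab, if_neg hji, neg_zero, mul_zero]
  · rw [← hb i, ← hb j, hνbb, mul_zero, h0 _ _ (hνbb i j)]

end LinearAlgebra

/-! ### The theorem -/

/-- **Every automorphism of the surface group is `±`-symplectic on `H₁(Σ_g; ℤ)`**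
(Zieschang–Vogt–Coldewey Thm. 3.6.7 (a), `AᵗKA = εK`, for automorphisms induced by homeomorphisms;
all automorphisms are, Nielsen 1927 / ZVC 3.3.11): for every automorphism `φ` of
`S_g = ⟨a₁,b₁,…,a_g,b_g ∣ ∏[aᵢ,bᵢ]⟩` there are a `ℤ`-linear automorphism `F` of `ℤ^{2g}` and a
sign `ε = ±1` with `ab ∘ φ = F ∘ ab` and `ν(F u, F v) = ε ν(u, v)` for all `u, v`, i.e.
`im(Aut S_g → GL_{2g}(ℤ)) ⊆ Sp^{±}(2g, ℤ)`.  Algebraic proof: `F` exists by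
`exists_linearEquiv_abelianize`; by the Heisenberg divisibility
(`symplForm_dvd_symplForm_pullback`) for `φ` and for `φ⁻¹`, `|ν(Fᵀu, Fᵀv)| = |ν(u, v)|`; the
sign is uniform (`exists_sign_of_natAbs_eq_symplForm`); transpose back
(`symplForm_map_map_of_transpose`). [cite: ZieschangVogtColdewey1980, Thm 3.6.7 (a)] -/
theorem SurfaceGroup.exists_linearEquiv_symplectic (g : ℕ) (φ : SurfaceGroup g ≃* SurfaceGroup g) :
    ∃ (F : (surfaceGen g → ℤ) ≃ₗ[ℤ] (surfaceGen g → ℤ)) (ε : ℤ), (ε = 1 ∨ ε = -1) ∧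
      (∀ s : SurfaceGroup g,
        toAdd (SurfaceGroup.abelianize g (φ s)) = F (toAdd (SurfaceGroup.abelianize g s))) ∧
      ∀ u v : surfaceGen g → ℤ, symplForm (F u) (F v) = ε * symplForm u v := by
  classical
  obtain ⟨F, hF⟩ := SurfaceGroup.exists_linearEquiv_abelianize φ
  have hG : ∀ s, toAdd (SurfaceGroup.abelianize g (φ.symm s)) =
      F.symm (toAdd (SurfaceGroup.abelianize g s)) := fun s => by
    have := hF (φ.symm s)
    rw [MulEquiv.apply_symm_apply] at this
    rw [this, LinearEquiv.symm_apply_apply]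
  have hFof : ∀ x,
      toAdd (SurfaceGroup.abelianize g (φ (PresentedGroup.of x))) = F (Pi.single x 1) := fun x => by
    rw [hF, SurfaceGroup.abelianize_of, toAdd_ofAdd]
  have hGof : ∀ x, toAdd (SurfaceGroup.abelianize g (φ.symm (PresentedGroup.of x))) =
      F.symm (Pi.single x 1) := fun x => by rw [hG, SurfaceGroup.abelianize_of, toAdd_ofAdd]
  -- the transposes `Ft = Fᵀ`, `Gt = (F⁻¹)ᵀ` in the letter basis (`Ft` bundled linearly)
  obtain ⟨T, hT⟩ : ∃ T : (surfaceGen g → ℤ) →ₗ[ℤ] (surfaceGen g → ℤ),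
      ∀ u, T u = fun x => F (Pi.single x 1) ⬝ᵥ u :=
    ⟨LinearMap.pi fun x => dotProductBilin ℤ ℤ (F (Pi.single x 1)), fun u => rfl⟩
  obtain ⟨Gt, hGt⟩ : ∃ Gt : (surfaceGen g → ℤ) → (surfaceGen g → ℤ),
      ∀ u, Gt u = fun x => F.symm (Pi.single x 1) ⬝ᵥ u := ⟨_, fun u => rfl⟩
  have hT_dot : ∀ u w, T u ⬝ᵥ w = F w ⬝ᵥ u := fun u w => by
    rw [hT]
    exact dotProduct_transpose_apply F.toLinearMap u w
  have hGt_dot : ∀ u w, Gt u ⬝ᵥ w = F.symm w ⬝ᵥ u := fun u w => by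
    rw [hGt]
    exact dotProduct_transpose_apply F.symm.toLinearMap u w
  have hGtT : ∀ u, Gt (T u) = u := fun u =>
    eq_of_dotProduct_eq_right fun w => by
      rw [hGt_dot, dotProduct_comm, hT_dot, LinearEquiv.apply_symm_apply, dotProduct_comm]
  -- Heisenberg divisibility for `φ` and `φ⁻¹`
  have d1 : ∀ u v, symplForm u v ∣ symplForm (T u) (T v) := fun u v => by
    have := SurfaceGroup.symplForm_dvd_symplForm_pullback φ.toMonoidHom u v
    simp only [MulEquiv.coe_toMonoidHom, hFof] at this
    rwa [hT, hT]
  have d2 : ∀ u v, symplForm u v ∣ symplForm (Gt u) (Gt v) := fun u v => by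
    have := SurfaceGroup.symplForm_dvd_symplForm_pullback φ.symm.toMonoidHom u v
    simp only [MulEquiv.coe_toMonoidHom, hGof] at this
    rwa [hGt, hGt]
  have habs : ∀ u v, (symplForm (T u) (T v)).natAbs = (symplForm u v).natAbs := fun u v => by
    refine Nat.dvd_antisymm (Int.natAbs_dvd_natAbs.2 ?_) (Int.natAbs_dvd_natAbs.2 (d1 u v))
    have := d2 (T u) (T v)
    rwa [hGtT, hGtT] at this
  -- uniform sign, then transpose back
  obtain ⟨ε, hε, hB⟩ := exists_sign_of_natAbs_eq_symplForm (symplForm.compl₁₂ T T) fun u v => by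
    rw [LinearMap.compl₁₂_apply]
    exact habs u v
  refine ⟨F, ε, hε, hF, symplForm_map_map_of_transpose F.toLinearMap F.symm.toLinearMap
    (fun v => F.symm_apply_apply v) T hT_dot ε fun u v => ?_⟩
  rw [← hB, LinearMap.compl₁₂_apply]

end Literature.Topology.FourManifolds

end
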